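import Summits.ResolutionOfSingularities.ResolutionOfSingularities.Theorems.FrobeniusLadderFInjectiveMacaulayficationTauFloorBYChartIdent
import Summits.ResolutionOfSingularities.ResolutionOfSingularities.Theorems.FrobeniusLadderFInjectiveMacaulayficationTauFloorBTChart
import Summits.ResolutionOfSingularities.ResolutionOfSingularities.Theorems.FrobeniusLadderFInjectiveMacaulayficationTauFloorP2d4BNotFull
import Summits.ResolutionOfSingularities.ResolutionOfSingularities.Theorems.FrobeniusLadderFInjectiveMacaulayficationTauFloorP2d4BRow
import Summits.ResolutionOfSingularities.ResolutionOfSingularities.Theorems.FrobeniusLadderFInjectiveMacaulayficationTauFloorOneChartSymmetry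
import Summits.ResolutionOfSingularities.ResolutionOfSingularities.Theorems.FrobeniusLadderFInjectiveMacaulayficationLocalBlowupInputFromCharts
import Summits.ResolutionOfSingularities.ResolutionOfSingularities.Theorems.FrobeniusLadderFInjectiveMacaulayficationReesChartFacts
import HarnessLib

/-!
# (N2) ROW #3 INPUT SIDE, second half: the τ-floor `S′ = Bl_τ X → Spec 𝒪_{X,v}` of P2d4B is a LEGAL input (`I ≠ ⊥`, `Supp I ⊆ Regᶜ`, `S′` regular off the closed
# fibre, CM at every point), and ★★★ ROW #3 AS ONE TWO-SIDED KERNEL THEOREM `f4pos_row_three` (legal ∧ pos ∧ cured)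
# (crux `FInjectiveMacaulayfication` stmt-ResolutionOfSingularities-15315, chain w45a; res-L1-w45a-plan-1 g19 RULING R19.6 (3) «(N2) ROW #3 INPUT LEGALITY → stub-2:
# make row #3 two-sided»; shape = res-L1-w45a-stub-1's `TauFloorInputLegal.tauFloor_input_legal` / `TauFloorInputNotFull.f4pos_row_one` (row #1); seat res-L1-w45a-stub-2 g8)

[OURS · L1 W4.5a] Support file (`--supports stmt-ResolutionOfSingularities-15315 --as helper`); replaces the role of NO printed item; NOT a statement of any
manuscript; def-free; UNCONDITIONAL (`CharP k 2` where the specimen package / the row need it). AI-written (AI review is weaker than expert review).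

LETTERING (row #3, p630677): `X = Spec A₀`, `A₀ = k[X0..X4]/(f)`, `f = X4² + X0²X4 + X1³ + X2³ + X3⁵`, `v` the vertex, `τ = (x̄, ȳ, ū, t̄², z̄)`, `I = τ̃|_{Spec 𝒪_{X,v}}`.
THE FIVE CHARTS of `Bl_τ X = affineBlowup τ`: `D(x̄) ≅ T₂(1, X1³+X2³)` (p634333/p635410), `D(ȳ) ≅ T₂(X1², 1+X2³)` (p636315/`…TauFloorBYChartIdent`),
`D(ū) ≅ D(ȳ)` by the symmetry `X1 ↔ X2` of `f` and `τ` (§1, res-L1-w45a-stub-1's generic `TauFloorOneChartSymmetry.exists_blowupAlgebra_congr'`), `D(t̄²) ≅ C_T`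
(`…TauFloorBTChart`), and `D(z̄)`, which has NO point over `v` (§2: `1 = −(x̄·(x̄/z̄) + ȳ·(ȳ/z̄)² + ū·(ū/z̄)² + t̄·(t̄²/z̄)²) ∈ 𝔪_v·A₀[τ/z̄]`, from `f̄ = 0`).
* §1 `exists_swap_auto` (`X1 ↔ X2` on `A₀`: fixes `f`, fixes `τ`, `ȳ ↦ ū`); §2 `map_vertex_eq_top_z`;
* §3 ★ `cmCl_blowupAlgebra_x/_y/_u/_t` — CM at EVERY prime of the four chart rings (`ReesChartFacts.transport_cmCl` along the chart identifications; the towers are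
  CM by `FlatIntegralCM`); `cmCl_reesChart_over` — the five Rees charts are CM at every prime OVER `v`; `span_range_eq_tau`; ★ `cmCl_stalk_affineBlowup_over` —
  `Bl_τ X` satisfies the CM clause at every point over `v` (`LocalBlowupInputFromCharts.cmCl_stalk_affineBlowup_of_charts_over`, p627935);
* §4 ★★ `tauFloor_P2d4B_legal` [`CharP k 2`] — the four `S′`-side binders of `LocalFInjectivizationFibreAdmGe4` for EVERY blowing up `g : S′ → Spec 𝒪_{X,v}` along `I`
  (`LocalBlowupInputFromCharts.offFibre_regular_and_cmCl_over`: `X` regular off `v` — `P2d4BSpecimen.regular_of_ne_vertex`; `Supp τ̃ ∋ y ⤳ v ⇒ y = v`);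
* §5 ★★★ `f4pos_row_three` — ROW #3 TWO-SIDED: (legal) ∧ (pos: `TauFloorP2d4BNotFull.tauFloor_P2d4B_not_full`, p635954) ∧ (cured: `TauFloorP2d4BRow.tauFloor_P2d4B_row`,
  p630677), literally the shape of `TauFloorInputNotFull.f4pos_row_one`.
[folklore assembly; cite: GortzWedhorn2020, Prop. 13.91 (2), (13.19)] [cite: StacksProject, Tag 0804; Tag 02OS; Tag 01J7] [cite: Temkin2008, §2.1]
-/

-- single-problem summit: the doubled namespace component is forced
set_option linter.dupNamespace false
-- chart rings `blowupAlgebra τ (Ideal.Quotient.mk _ (X j))`: slow instance paths (as in p635410)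
set_option synthInstance.maxHeartbeats 400000

noncomputable section

namespace Summit.ResolutionOfSingularities.ResolutionOfSingularities.Theorems.FInjectiveMacaulayfication.TauFloorP2d4BLegal

open CategoryTheory AlgebraicGeometry TopologicalSpace IsLocalRing MvPolynomial IsLocalization
open Literature.AlgebraicGeometry.Resolution
open Summit.ResolutionOfSingularities.ResolutionOfSingularities.Theorems.FInjectiveMacaulayfication
open SliceableCentre GermOfGlobalBlowup

variable (k : Type) [Field k]

/-! ## §1 The symmetry `X1 ↔ X2` of P2d4B -/

/-- The transposition `X1 ↔ X2` fixes `f`, so induces `σ : A₀ ≃+* A₀` with `σ x̄ᵢ = x̄_{swap i}`; `σ` fixes `τ` and sends `ȳ` to `ū`. [plumbing; pattern p622567] -/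
theorem exists_swap_auto (f : MvPolynomial (Fin 5) k) (hf : f = X 4 ^ 2 + X 0 ^ 2 * X 4 + X 1 ^ 3 + X 2 ^ 3 + X 3 ^ 5) :
    ∃ σ : (MvPolynomial (Fin 5) k ⧸ Ideal.span {f}) ≃+* (MvPolynomial (Fin 5) k ⧸ Ideal.span {f}),
      (∀ i : Fin 5, σ (Ideal.Quotient.mk (Ideal.span {f}) (X i)) = Ideal.Quotient.mk (Ideal.span {f}) (X (Equiv.swap 1 2 i))) ∧
      Ideal.map σ (Ideal.span {Ideal.Quotient.mk (Ideal.span {f}) (X 0), Ideal.Quotient.mk (Ideal.span {f}) (X 1),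
          Ideal.Quotient.mk (Ideal.span {f}) (X 2), Ideal.Quotient.mk (Ideal.span {f}) (X 3) ^ 2, Ideal.Quotient.mk (Ideal.span {f}) (X 4)}) =
        Ideal.span {Ideal.Quotient.mk (Ideal.span {f}) (X 0), Ideal.Quotient.mk (Ideal.span {f}) (X 1),
          Ideal.Quotient.mk (Ideal.span {f}) (X 2), Ideal.Quotient.mk (Ideal.span {f}) (X 3) ^ 2, Ideal.Quotient.mk (Ideal.span {f}) (X 4)} ∧
      σ (Ideal.Quotient.mk (Ideal.span {f}) (X 1)) = Ideal.Quotient.mk (Ideal.span {f}) (X 2) := by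
  set ρ : MvPolynomial (Fin 5) k ≃+* MvPolynomial (Fin 5) k := (renameEquiv k (Equiv.swap (1 : Fin 5) 2)).toRingEquiv with hρ
  have hρX : ∀ i : Fin 5, ρ (X i) = X (Equiv.swap 1 2 i) := fun i => rename_X _ i
  have hρf : ρ f = f := by
    rw [hf]
    simp only [map_add, map_mul, map_pow, hρX]
    rw [show Equiv.swap (1 : Fin 5) 2 4 = 4 by decide, show Equiv.swap (1 : Fin 5) 2 0 = 0 by decide, Equiv.swap_apply_left,
      Equiv.swap_apply_right, show Equiv.swap (1 : Fin 5) 2 3 = 3 by decide]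
    ring
  have hIJ : Ideal.span {f} = Ideal.map (ρ : MvPolynomial (Fin 5) k →+* MvPolynomial (Fin 5) k) (Ideal.span {f}) := by
    rw [Ideal.map_span, Set.image_singleton]
    exact congrArg _ (congrArg _ hρf.symm)
  have himg : ∀ i : Fin 5, Ideal.quotientEquiv (Ideal.span {f}) (Ideal.span {f}) ρ hIJ (Ideal.Quotient.mk (Ideal.span {f}) (X i)) =
      Ideal.Quotient.mk (Ideal.span {f}) (X (Equiv.swap 1 2 i)) := fun i => by rw [Ideal.quotientEquiv_mk, hρX]
  refine ⟨Ideal.quotientEquiv (Ideal.span {f}) (Ideal.span {f}) ρ hIJ, himg, ?_, ?_⟩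
  · rw [Ideal.map_span]
    simp only [Set.image_insert_eq, Set.image_singleton, map_pow, himg]
    rw [show Equiv.swap (1 : Fin 5) 2 4 = 4 by decide, show Equiv.swap (1 : Fin 5) 2 0 = 0 by decide, Equiv.swap_apply_left,
      Equiv.swap_apply_right, show Equiv.swap (1 : Fin 5) 2 3 = 3 by decide]
    exact congrArg Ideal.span (by ext; simp only [Set.mem_insert_iff, Set.mem_singleton_iff]; tauto)
  · rw [himg, Equiv.swap_apply_left]

/-! ## §2 The chart `D(z̄)` has no point over the vertex -/

set_option maxHeartbeats 800000 in
-- one identity in `A₀[1/z̄]` plus subalgebra membership bookkeeping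
/-- **`𝔪_v · A₀[τ/z̄] = (1)`**: in `A₀[1/z̄]`, `f̄ = 0` divided by `z̄²` reads `1 = −(x̄·(x̄/z̄) + ȳ·(ȳ/z̄)² + ū·(ū/z̄)² + t̄·(t̄²/z̄)²)`, a combination of the images of
`x̄, ȳ, ū, t̄ ∈ 𝔪_v` with coefficients in `A₀[τ/z̄]`. So the chart `D(z̄)` of `Bl_τ X` has no point over `v`. [folklore] -/
theorem map_vertex_eq_top_z (f : MvPolynomial (Fin 5) k) (hf : f = X 4 ^ 2 + X 0 ^ 2 * X 4 + X 1 ^ 3 + X 2 ^ 3 + X 3 ^ 5)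
    (v : Spec (.of (MvPolynomial (Fin 5) k ⧸ Ideal.span {f})))
    (hv : v.asIdeal = Ideal.span (Set.range fun j : Fin 5 => Ideal.Quotient.mk (Ideal.span {f}) (X j))) :
    v.asIdeal.map (algebraMap (MvPolynomial (Fin 5) k ⧸ Ideal.span {f}) (blowupAlgebra (Ideal.span {Ideal.Quotient.mk (Ideal.span {f}) (X 0), Ideal.Quotient.mk (Ideal.span {f}) (X 1),
          Ideal.Quotient.mk (Ideal.span {f}) (X 2), Ideal.Quotient.mk (Ideal.span {f}) (X 3) ^ 2, Ideal.Quotient.mk (Ideal.span {f}) (X 4)} :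
            Ideal (MvPolynomial (Fin 5) k ⧸ Ideal.span {f})) (Ideal.Quotient.mk (Ideal.span {f}) (X 4)))) = ⊤ := by
  classical
  set B := blowupAlgebra (Ideal.span {Ideal.Quotient.mk (Ideal.span {f}) (X 0), Ideal.Quotient.mk (Ideal.span {f}) (X 1),
          Ideal.Quotient.mk (Ideal.span {f}) (X 2), Ideal.Quotient.mk (Ideal.span {f}) (X 3) ^ 2, Ideal.Quotient.mk (Ideal.span {f}) (X 4)} :
            Ideal (MvPolynomial (Fin 5) k ⧸ Ideal.span {f})) (Ideal.Quotient.mk (Ideal.span {f}) (X 4)) with hB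
  have hF : algebraMap (MvPolynomial (Fin 5) k ⧸ Ideal.span {f}) (Localization.Away (Ideal.Quotient.mk (Ideal.span {f}) (X 4) : MvPolynomial (Fin 5) k ⧸ Ideal.span {f})) (Ideal.Quotient.mk (Ideal.span {f}) (X 4)) ^ 2 +
      algebraMap (MvPolynomial (Fin 5) k ⧸ Ideal.span {f}) (Localization.Away (Ideal.Quotient.mk (Ideal.span {f}) (X 4) : MvPolynomial (Fin 5) k ⧸ Ideal.span {f})) (Ideal.Quotient.mk (Ideal.span {f}) (X 0)) ^ 2 *
        algebraMap (MvPolynomial (Fin 5) k ⧸ Ideal.span {f}) (Localization.Away (Ideal.Quotient.mk (Ideal.span {f}) (X 4) : MvPolynomial (Fin 5) k ⧸ Ideal.span {f})) (Ideal.Quotient.mk (Ideal.span {f}) (X 4)) +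
      algebraMap (MvPolynomial (Fin 5) k ⧸ Ideal.span {f}) (Localization.Away (Ideal.Quotient.mk (Ideal.span {f}) (X 4) : MvPolynomial (Fin 5) k ⧸ Ideal.span {f})) (Ideal.Quotient.mk (Ideal.span {f}) (X 1)) ^ 3 +
      algebraMap (MvPolynomial (Fin 5) k ⧸ Ideal.span {f}) (Localization.Away (Ideal.Quotient.mk (Ideal.span {f}) (X 4) : MvPolynomial (Fin 5) k ⧸ Ideal.span {f})) (Ideal.Quotient.mk (Ideal.span {f}) (X 2)) ^ 3 +
      algebraMap (MvPolynomial (Fin 5) k ⧸ Ideal.span {f}) (Localization.Away (Ideal.Quotient.mk (Ideal.span {f}) (X 4) : MvPolynomial (Fin 5) k ⧸ Ideal.span {f})) (Ideal.Quotient.mk (Ideal.span {f}) (X 3)) ^ 5 = 0 := by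
    have h0 : Ideal.Quotient.mk (Ideal.span {f}) (X 4 ^ 2 + X 0 ^ 2 * X 4 + X 1 ^ 3 + X 2 ^ 3 + X 3 ^ 5 : MvPolynomial (Fin 5) k) = 0 := by
      rw [← hf]; exact Ideal.Quotient.eq_zero_iff_mem.mpr (Ideal.mem_span_singleton_self f)
    have h1 := congrArg (algebraMap (MvPolynomial (Fin 5) k ⧸ Ideal.span {f}) (Localization.Away (Ideal.Quotient.mk (Ideal.span {f}) (X 4) : MvPolynomial (Fin 5) k ⧸ Ideal.span {f}))) h0
    rw [map_zero] at h1
    simpa only [map_add, map_mul, map_pow] using h1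
  have hzi : algebraMap (MvPolynomial (Fin 5) k ⧸ Ideal.span {f}) (Localization.Away (Ideal.Quotient.mk (Ideal.span {f}) (X 4) : MvPolynomial (Fin 5) k ⧸ Ideal.span {f})) (Ideal.Quotient.mk (Ideal.span {f}) (X 4)) * Away.invSelf (Ideal.Quotient.mk (Ideal.span {f}) (X 4)) = 1 := Away.mul_invSelf _
  -- the chart elements `x̄/z̄, ȳ/z̄, ū/z̄, t̄²/z̄ ∈ B`
  have hgen : ∀ g : MvPolynomial (Fin 5) k ⧸ Ideal.span {f}, g ∈ (Ideal.span {Ideal.Quotient.mk (Ideal.span {f}) (X 0), Ideal.Quotient.mk (Ideal.span {f}) (X 1),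
          Ideal.Quotient.mk (Ideal.span {f}) (X 2), Ideal.Quotient.mk (Ideal.span {f}) (X 3) ^ 2, Ideal.Quotient.mk (Ideal.span {f}) (X 4)} :
            Ideal (MvPolynomial (Fin 5) k ⧸ Ideal.span {f})) →
      algebraMap (MvPolynomial (Fin 5) k ⧸ Ideal.span {f}) (Localization.Away (Ideal.Quotient.mk (Ideal.span {f}) (X 4) : MvPolynomial (Fin 5) k ⧸ Ideal.span {f})) g * Away.invSelf (Ideal.Quotient.mk (Ideal.span {f}) (X 4)) ∈ B := fun g hg => div_mem_blowupAlgebra _ _ hg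
  have hx := hgen _ (Ideal.subset_span (by simp : Ideal.Quotient.mk (Ideal.span {f}) (X 0) ∈ _))
  have hy := hgen _ (Ideal.subset_span (by simp : Ideal.Quotient.mk (Ideal.span {f}) (X 1) ∈ _))
  have hu := hgen _ (Ideal.subset_span (by simp : Ideal.Quotient.mk (Ideal.span {f}) (X 2) ∈ _))
  have ht := hgen _ (Ideal.subset_span (by simp : Ideal.Quotient.mk (Ideal.span {f}) (X 3) ^ 2 ∈ _))
  rw [map_pow] at ht
  -- the vertex ideal contains `x̄, ȳ, ū, t̄`
  have hvm : ∀ j : Fin 5, Ideal.Quotient.mk (Ideal.span {f}) (X j) ∈ v.asIdeal := fun j => by rw [hv]; exact Ideal.subset_span ⟨j, rfl⟩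
  -- generalize the atoms and prove `1 ∈ 𝔪_v B`
  rw [Ideal.eq_top_iff_one]
  have key : ∀ (i a0 a1 a2 a3 a4 : Localization.Away (Ideal.Quotient.mk (Ideal.span {f}) (X 4) : MvPolynomial (Fin 5) k ⧸ Ideal.span {f}))
      (hzi : a4 * i = 1) (hF : a4 ^ 2 + a0 ^ 2 * a4 + a1 ^ 3 + a2 ^ 3 + a3 ^ 5 = 0),
      (1 : Localization.Away (Ideal.Quotient.mk (Ideal.span {f}) (X 4) : MvPolynomial (Fin 5) k ⧸ Ideal.span {f})) = -(a0 * (a0 * i) + a1 * (a1 * i) ^ 2 + a2 * (a2 * i) ^ 2 + a3 * (a3 ^ 2 * i) ^ 2) := by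
    intro i a0 a1 a2 a3 a4 hzi hF
    linear_combination (i ^ 2) * hF - (1 + a4 * i + a0 ^ 2 * i) * hzi
  have h1 := key _ _ _ _ _ _ hzi hF
  -- as an identity in the subalgebra `B`
  have hmem : ∀ (j : Fin 5) (b : B), algebraMap (MvPolynomial (Fin 5) k ⧸ Ideal.span {f}) B (Ideal.Quotient.mk (Ideal.span {f}) (X j)) * b ∈ v.asIdeal.map (algebraMap (MvPolynomial (Fin 5) k ⧸ Ideal.span {f}) B) :=
    fun j b => Ideal.mul_mem_right _ _ (Ideal.mem_map_of_mem _ (hvm j))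
  have hsum : (1 : B) = -(algebraMap (MvPolynomial (Fin 5) k ⧸ Ideal.span {f}) B (Ideal.Quotient.mk (Ideal.span {f}) (X 0)) * ⟨_, hx⟩ + algebraMap (MvPolynomial (Fin 5) k ⧸ Ideal.span {f}) B (Ideal.Quotient.mk (Ideal.span {f}) (X 1)) * ⟨_, hy⟩ ^ 2 +
      algebraMap (MvPolynomial (Fin 5) k ⧸ Ideal.span {f}) B (Ideal.Quotient.mk (Ideal.span {f}) (X 2)) * ⟨_, hu⟩ ^ 2 + algebraMap (MvPolynomial (Fin 5) k ⧸ Ideal.span {f}) B (Ideal.Quotient.mk (Ideal.span {f}) (X 3)) * ⟨_, ht⟩ ^ 2) := by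
    apply Subtype.ext
    simp only [Subalgebra.coe_one, Subalgebra.coe_neg, Subalgebra.coe_add, Subalgebra.coe_mul, Subalgebra.coe_pow, Subalgebra.coe_algebraMap]
    exact h1
  rw [hsum, neg_mem_iff]
  exact Ideal.add_mem _ (Ideal.add_mem _ (Ideal.add_mem _ (hmem 0 ⟨_, hx⟩) (hmem 1 (⟨_, hy⟩ ^ 2))) (hmem 2 (⟨_, hu⟩ ^ 2))) (hmem 3 (⟨_, ht⟩ ^ 2))

/-! ## §3 CM at every prime of the chart rings; CM of `Bl_τ X` over `v` -/

/-- ★ **`D(x̄)`: CM at every prime of `A₀[τ/x̄]`** (`≅ T₂(1, X1³+X2³)`, p634333 + p635410). [folklore transport] -/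
theorem cmCl_blowupAlgebra_x (f : MvPolynomial (Fin 5) k) (hf : f = X 4 ^ 2 + X 0 ^ 2 * X 4 + X 1 ^ 3 + X 2 ^ 3 + X 3 ^ 5)
    (Q : Ideal (blowupAlgebra (Ideal.span {Ideal.Quotient.mk (Ideal.span {f}) (X 0), Ideal.Quotient.mk (Ideal.span {f}) (X 1),
          Ideal.Quotient.mk (Ideal.span {f}) (X 2), Ideal.Quotient.mk (Ideal.span {f}) (X 3) ^ 2, Ideal.Quotient.mk (Ideal.span {f}) (X 4)} :
            Ideal (MvPolynomial (Fin 5) k ⧸ Ideal.span {f})) (Ideal.Quotient.mk (Ideal.span {f}) (X 0)))) [Q.IsPrime] :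
    CMCl (Localization.AtPrime Q) := by
  set h₁ : Polynomial (MvPolynomial (Fin 4) k) := Polynomial.X ^ 2 - Polynomial.C (X 0 * X 3) with hh₁
  set h₂ : Polynomial (AdjoinRoot h₁) := Polynomial.X ^ 2 + (Polynomial.C (algebraMap (MvPolynomial (Fin 4) k) (AdjoinRoot h₁) (X 0)) * Polynomial.X +
      Polynomial.C (algebraMap (MvPolynomial (Fin 4) k) (AdjoinRoot h₁) (X 0 * (X 1 ^ 3 + X 2 ^ 3)) +
        AdjoinRoot.root h₁ * algebraMap (MvPolynomial (Fin 4) k) (AdjoinRoot h₁) (X 3 ^ 2))) with hh₂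
  obtain ⟨e, -⟩ := TauFloorBXChartIdent.exists_chartEquiv k f hf h₁ hh₁ h₂ hh₂
  exact ReesChartFacts.transport_cmCl e (fun Q' _ => TauFloorBXChartAlgebra.cmCl_localization k h₁ hh₁ h₂ hh₂ Q') Q

/-- ★ **`D(ȳ)`: CM at every prime of `A₀[τ/ȳ]`** (`≅ T₂(X1², 1+X2³)`). [folklore transport] -/
theorem cmCl_blowupAlgebra_y (f : MvPolynomial (Fin 5) k) (hf : f = X 4 ^ 2 + X 0 ^ 2 * X 4 + X 1 ^ 3 + X 2 ^ 3 + X 3 ^ 5)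
    (Q : Ideal (blowupAlgebra (Ideal.span {Ideal.Quotient.mk (Ideal.span {f}) (X 0), Ideal.Quotient.mk (Ideal.span {f}) (X 1),
          Ideal.Quotient.mk (Ideal.span {f}) (X 2), Ideal.Quotient.mk (Ideal.span {f}) (X 3) ^ 2, Ideal.Quotient.mk (Ideal.span {f}) (X 4)} :
            Ideal (MvPolynomial (Fin 5) k ⧸ Ideal.span {f})) (Ideal.Quotient.mk (Ideal.span {f}) (X 1)))) [Q.IsPrime] :
    CMCl (Localization.AtPrime Q) := by
  set h₁ : Polynomial (MvPolynomial (Fin 4) k) := Polynomial.X ^ 2 - Polynomial.C (X 0 * X 3) with hh₁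
  set h₂ : Polynomial (AdjoinRoot h₁) := Polynomial.X ^ 2 + (Polynomial.C (algebraMap (MvPolynomial (Fin 4) k) (AdjoinRoot h₁) (X 0 * X 1 ^ 2)) * Polynomial.X +
      Polynomial.C (algebraMap (MvPolynomial (Fin 4) k) (AdjoinRoot h₁) (X 0 * (1 + X 2 ^ 3)) +
        AdjoinRoot.root h₁ * algebraMap (MvPolynomial (Fin 4) k) (AdjoinRoot h₁) (X 3 ^ 2))) with hh₂
  obtain ⟨e, -⟩ := TauFloorBYChartIdent.exists_chartEquiv k f hf h₁ hh₁ h₂ hh₂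
  exact ReesChartFacts.transport_cmCl e (fun Q' _ => TauFloorBMonicTower.cmCl_localization k h₁ hh₁ (X 1 ^ 2) (1 + X 2 ^ 3) h₂ hh₂ Q') Q

/-- ★ **`D(ū)`: CM at every prime of `A₀[τ/ū]`** (from `D(ȳ)` along the symmetry `X1 ↔ X2`). [folklore transport] -/
theorem cmCl_blowupAlgebra_u (f : MvPolynomial (Fin 5) k) (hf : f = X 4 ^ 2 + X 0 ^ 2 * X 4 + X 1 ^ 3 + X 2 ^ 3 + X 3 ^ 5)
    (Q : Ideal (blowupAlgebra (Ideal.span {Ideal.Quotient.mk (Ideal.span {f}) (X 0), Ideal.Quotient.mk (Ideal.span {f}) (X 1),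
          Ideal.Quotient.mk (Ideal.span {f}) (X 2), Ideal.Quotient.mk (Ideal.span {f}) (X 3) ^ 2, Ideal.Quotient.mk (Ideal.span {f}) (X 4)} :
            Ideal (MvPolynomial (Fin 5) k ⧸ Ideal.span {f})) (Ideal.Quotient.mk (Ideal.span {f}) (X 2)))) [Q.IsPrime] :
    CMCl (Localization.AtPrime Q) := by
  obtain ⟨σ, -, hτ, hy⟩ := exists_swap_auto k f hf
  obtain ⟨E₀, -⟩ := TauFloorOneChartSymmetry.exists_blowupAlgebra_congr' σ _ _ hτ _ _ hy
  exact ReesChartFacts.transport_cmCl E₀ (fun Q' _ => cmCl_blowupAlgebra_y k f hf Q') Q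

/-- ★ **`D(t̄²)`: CM at every prime of `A₀[τ/t̄²]`** (`≅ C_T`). [folklore transport] -/
theorem cmCl_blowupAlgebra_t (f : MvPolynomial (Fin 5) k) (hf : f = X 4 ^ 2 + X 0 ^ 2 * X 4 + X 1 ^ 3 + X 2 ^ 3 + X 3 ^ 5)
    (Q : Ideal (blowupAlgebra (Ideal.span {Ideal.Quotient.mk (Ideal.span {f}) (X 0), Ideal.Quotient.mk (Ideal.span {f}) (X 1),
          Ideal.Quotient.mk (Ideal.span {f}) (X 2), Ideal.Quotient.mk (Ideal.span {f}) (X 3) ^ 2, Ideal.Quotient.mk (Ideal.span {f}) (X 4)} :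
            Ideal (MvPolynomial (Fin 5) k ⧸ Ideal.span {f})) (Ideal.Quotient.mk (Ideal.span {f}) (X 3) ^ 2))) [Q.IsPrime] :
    CMCl (Localization.AtPrime Q) := by
  set g₀ : Polynomial (MvPolynomial (Fin 4) k) :=
    Polynomial.X ^ 2 + (Polynomial.C (X 3 ^ 2 * X 0 ^ 2) * Polynomial.X + Polynomial.C (X 3 ^ 2 * (X 1 ^ 3 + X 2 ^ 3) + X 3)) with hg₀
  obtain ⟨e, -⟩ := TauFloorBTChart.exists_chartEquiv k f hf g₀ hg₀
  exact ReesChartFacts.transport_cmCl e (fun Q' _ => TauFloorBTChart.cmCl_localization k g₀ hg₀ Q') Q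

/-- **The five Rees charts `(A₀[τt])_{(at)}`, `a ∈ {x̄, ȳ, ū, t̄², z̄}`, are CM at every prime OVER `v`** (the first four at every prime; the last has none over `v`).
[folklore assembly] -/
theorem cmCl_reesChart_over (f : MvPolynomial (Fin 5) k) (hf : f = X 4 ^ 2 + X 0 ^ 2 * X 4 + X 1 ^ 3 + X 2 ^ 3 + X 3 ^ 5)
    (v : Spec (.of (MvPolynomial (Fin 5) k ⧸ Ideal.span {f})))
    (hv : v.asIdeal = Ideal.span (Set.range fun j : Fin 5 => Ideal.Quotient.mk (Ideal.span {f}) (X j)))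
    (a : MvPolynomial (Fin 5) k ⧸ Ideal.span {f}) (ha : a ∈ (Ideal.span {Ideal.Quotient.mk (Ideal.span {f}) (X 0), Ideal.Quotient.mk (Ideal.span {f}) (X 1),
          Ideal.Quotient.mk (Ideal.span {f}) (X 2), Ideal.Quotient.mk (Ideal.span {f}) (X 3) ^ 2, Ideal.Quotient.mk (Ideal.span {f}) (X 4)} :
            Ideal (MvPolynomial (Fin 5) k ⧸ Ideal.span {f})))
    (h : a = Ideal.Quotient.mk (Ideal.span {f}) (X 0) ∨ a = Ideal.Quotient.mk (Ideal.span {f}) (X 1) ∨ a = Ideal.Quotient.mk (Ideal.span {f}) (X 2) ∨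
      a = Ideal.Quotient.mk (Ideal.span {f}) (X 3) ^ 2 ∨ a = Ideal.Quotient.mk (Ideal.span {f}) (X 4))
    (q : PrimeSpectrum (HomogeneousLocalization.Away (reesGrading (Ideal.span {Ideal.Quotient.mk (Ideal.span {f}) (X 0), Ideal.Quotient.mk (Ideal.span {f}) (X 1),
          Ideal.Quotient.mk (Ideal.span {f}) (X 2), Ideal.Quotient.mk (Ideal.span {f}) (X 3) ^ 2, Ideal.Quotient.mk (Ideal.span {f}) (X 4)} :
            Ideal (MvPolynomial (Fin 5) k ⧸ Ideal.span {f}))) (reesT a ha)))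
    (hq : PrimeSpectrum.comap (reesChartBase a ha) q = v) : CMCl (Localization.AtPrime q.asIdeal) := by
  rcases h with rfl | rfl | rfl | rfl | rfl
  · exact ReesChartFacts.reesChart_cmCl_of_blowupAlgebra_cmCl _ _ ha (fun Q _ => cmCl_blowupAlgebra_x k f hf Q) q.asIdeal
  · exact ReesChartFacts.reesChart_cmCl_of_blowupAlgebra_cmCl _ _ ha (fun Q _ => cmCl_blowupAlgebra_y k f hf Q) q.asIdeal
  · exact ReesChartFacts.reesChart_cmCl_of_blowupAlgebra_cmCl _ _ ha (fun Q _ => cmCl_blowupAlgebra_u k f hf Q) q.asIdeal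
  · exact ReesChartFacts.reesChart_cmCl_of_blowupAlgebra_cmCl _ _ ha (fun Q _ => cmCl_blowupAlgebra_t k f hf Q) q.asIdeal
  · exact absurd hq (LocalBlowupInputFromCharts.not_comap_eq_of_map_eq_top _ _ ha v (map_vertex_eq_top_z k f hf v hv) q)

/-- The generator vector presents `τ`. [plumbing] -/
theorem span_range_eq_tau (f : MvPolynomial (Fin 5) k) :
    Ideal.span (Set.range ![Ideal.Quotient.mk (Ideal.span {f}) (X 0), Ideal.Quotient.mk (Ideal.span {f}) (X 1), Ideal.Quotient.mk (Ideal.span {f}) (X 2),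
        Ideal.Quotient.mk (Ideal.span {f}) (X 3) ^ 2, Ideal.Quotient.mk (Ideal.span {f}) (X 4)]) =
      (Ideal.span {Ideal.Quotient.mk (Ideal.span {f}) (X 0), Ideal.Quotient.mk (Ideal.span {f}) (X 1),
          Ideal.Quotient.mk (Ideal.span {f}) (X 2), Ideal.Quotient.mk (Ideal.span {f}) (X 3) ^ 2, Ideal.Quotient.mk (Ideal.span {f}) (X 4)} :
            Ideal (MvPolynomial (Fin 5) k ⧸ Ideal.span {f})) := by
  simp only [Matrix.range_cons, Matrix.range_empty, Set.union_empty, Set.singleton_union]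

/-- ★ **`Bl_τ X = affineBlowup τ` satisfies the CM clause at EVERY point over the vertex.** [folklore assembly; cite: StacksProject, Tag 0804] -/
theorem cmCl_stalk_affineBlowup_over (f : MvPolynomial (Fin 5) k) (hf : f = X 4 ^ 2 + X 0 ^ 2 * X 4 + X 1 ^ 3 + X 2 ^ 3 + X 3 ^ 5)
    (v : Spec (.of (MvPolynomial (Fin 5) k ⧸ Ideal.span {f})))
    (hv : v.asIdeal = Ideal.span (Set.range fun j : Fin 5 => Ideal.Quotient.mk (Ideal.span {f}) (X j)))
    (y : ↥(affineBlowup (Ideal.span {Ideal.Quotient.mk (Ideal.span {f}) (X 0), Ideal.Quotient.mk (Ideal.span {f}) (X 1),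
          Ideal.Quotient.mk (Ideal.span {f}) (X 2), Ideal.Quotient.mk (Ideal.span {f}) (X 3) ^ 2, Ideal.Quotient.mk (Ideal.span {f}) (X 4)} :
            Ideal (MvPolynomial (Fin 5) k ⧸ Ideal.span {f})))) (hy : (affineBlowup.π _).base y = v) :
    CMCl ((affineBlowup (Ideal.span {Ideal.Quotient.mk (Ideal.span {f}) (X 0), Ideal.Quotient.mk (Ideal.span {f}) (X 1),
          Ideal.Quotient.mk (Ideal.span {f}) (X 2), Ideal.Quotient.mk (Ideal.span {f}) (X 3) ^ 2, Ideal.Quotient.mk (Ideal.span {f}) (X 4)} :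
            Ideal (MvPolynomial (Fin 5) k ⧸ Ideal.span {f}))).presheaf.stalk y) := by
  have key : ∀ (J : Ideal (MvPolynomial (Fin 5) k ⧸ Ideal.span {f})), J = Ideal.span {Ideal.Quotient.mk (Ideal.span {f}) (X 0), Ideal.Quotient.mk (Ideal.span {f}) (X 1),
          Ideal.Quotient.mk (Ideal.span {f}) (X 2), Ideal.Quotient.mk (Ideal.span {f}) (X 3) ^ 2, Ideal.Quotient.mk (Ideal.span {f}) (X 4)} →
      ∀ (i : Fin 5) (hi : (![Ideal.Quotient.mk (Ideal.span {f}) (X 0), Ideal.Quotient.mk (Ideal.span {f}) (X 1), Ideal.Quotient.mk (Ideal.span {f}) (X 2),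
        Ideal.Quotient.mk (Ideal.span {f}) (X 3) ^ 2, Ideal.Quotient.mk (Ideal.span {f}) (X 4)] i) ∈ J)
        (q : PrimeSpectrum (HomogeneousLocalization.Away (reesGrading J) (reesT _ hi))),
        PrimeSpectrum.comap (reesChartBase _ hi) q = v → CMCl (Localization.AtPrime q.asIdeal) := by
    rintro J rfl i hi q hq
    refine cmCl_reesChart_over k f hf v hv _ hi ?_ q hq
    fin_cases i
    exacts [Or.inl rfl, Or.inr (Or.inl rfl), Or.inr (Or.inr (Or.inl rfl)), Or.inr (Or.inr (Or.inr (Or.inl rfl))), Or.inr (Or.inr (Or.inr (Or.inr rfl)))]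
  have h := LocalBlowupInputFromCharts.cmCl_stalk_affineBlowup_of_charts_over _ v (fun i _ q hq => key _ (span_range_eq_tau k f) i _ q hq)
  rw [span_range_eq_tau k f] at h
  exact h y hy

/-! ## §4 ★★ The τ-floor of P2d4B is a LEGAL input -/

/-- ★★ **(N2) LEGALITY: the four `S′`-side binders of `LocalFInjectivizationFibreAdmGe4` hold for EVERY blowing up `g : S′ → Spec 𝒪_{X,v}` along `I = τ̃|`**:
(1) `I ≠ ⊥`; (2) `Supp I ⊆ (Reg Spec 𝒪_{X,v})ᶜ`; (3) `S′` is regular off the closed fibre; (4) `S′` satisfies the CM clause at every point.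
[folklore assembly; cite: GortzWedhorn2020, Prop. 13.91 (2), (13.19)] [cite: StacksProject, Tag 02OS; Tag 01J7] [cite: Temkin2008, §2.1] -/
theorem tauFloor_P2d4B_legal [CharP k 2] (f : MvPolynomial (Fin 5) k) (hf : f = X 4 ^ 2 + X 0 ^ 2 * X 4 + X 1 ^ 3 + X 2 ^ 3 + X 3 ^ 5)
    (v : Spec (.of (MvPolynomial (Fin 5) k ⧸ Ideal.span {f})))
    (hv : v.asIdeal = Ideal.span (Set.range fun j : Fin 5 => Ideal.Quotient.mk (Ideal.span {f}) (X j)))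
    (S' : Scheme.{0}) (g : S' ⟶ Spec ((Spec (.of (MvPolynomial (Fin 5) k ⧸ Ideal.span {f}))).presheaf.stalk v))
    (hg : IsBlowup g ((affineBlowup.idealSheaf
        (Ideal.span {Ideal.Quotient.mk (Ideal.span {f}) (X 0), Ideal.Quotient.mk (Ideal.span {f}) (X 1),
          Ideal.Quotient.mk (Ideal.span {f}) (X 2), Ideal.Quotient.mk (Ideal.span {f}) (X 3) ^ 2, Ideal.Quotient.mk (Ideal.span {f}) (X 4)})).comap
        ((Spec (.of (MvPolynomial (Fin 5) k ⧸ Ideal.span {f}))).fromSpecStalk v))) :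
    (affineBlowup.idealSheaf
        (Ideal.span {Ideal.Quotient.mk (Ideal.span {f}) (X 0), Ideal.Quotient.mk (Ideal.span {f}) (X 1),
          Ideal.Quotient.mk (Ideal.span {f}) (X 2), Ideal.Quotient.mk (Ideal.span {f}) (X 3) ^ 2, Ideal.Quotient.mk (Ideal.span {f}) (X 4)})).comap
        ((Spec (.of (MvPolynomial (Fin 5) k ⧸ Ideal.span {f}))).fromSpecStalk v) ≠ ⊥ ∧
    ((((affineBlowup.idealSheaf
        (Ideal.span {Ideal.Quotient.mk (Ideal.span {f}) (X 0), Ideal.Quotient.mk (Ideal.span {f}) (X 1),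
          Ideal.Quotient.mk (Ideal.span {f}) (X 2), Ideal.Quotient.mk (Ideal.span {f}) (X 3) ^ 2, Ideal.Quotient.mk (Ideal.span {f}) (X 4)})).comap
        ((Spec (.of (MvPolynomial (Fin 5) k ⧸ Ideal.span {f}))).fromSpecStalk v)).support :
          Set (Spec ((Spec (.of (MvPolynomial (Fin 5) k ⧸ Ideal.span {f}))).presheaf.stalk v))) ⊆
      (Scheme.regularLocus (Spec ((Spec (.of (MvPolynomial (Fin 5) k ⧸ Ideal.span {f}))).presheaf.stalk v)))ᶜ) ∧
    (∀ s : S', g.base s ≠ closedPoint ((Spec (.of (MvPolynomial (Fin 5) k ⧸ Ideal.span {f}))).presheaf.stalk v) → s ∈ Scheme.regularLocus S') ∧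
    (∀ s : S', CMCl (S'.presheaf.stalk s)) := by
  classical
  haveI := P2d4BSpecimen.isIntegral_p2d4b k f hf
  -- the support `V(τ)` of `τ̃` meets the generizations of `v` only in `v`
  have hsupp : ∀ y ∈ ((affineBlowup.idealSheaf (Ideal.span {Ideal.Quotient.mk (Ideal.span {f}) (X 0), Ideal.Quotient.mk (Ideal.span {f}) (X 1),
          Ideal.Quotient.mk (Ideal.span {f}) (X 2), Ideal.Quotient.mk (Ideal.span {f}) (X 3) ^ 2, Ideal.Quotient.mk (Ideal.span {f}) (X 4)} :
            Ideal (MvPolynomial (Fin 5) k ⧸ Ideal.span {f}))).support : Set (Spec (.of (MvPolynomial (Fin 5) k ⧸ Ideal.span {f})))), y ⤳ v → y = v := by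
    intro y hy hyv
    rw [affineBlowup.support_idealSheaf] at hy
    have hτy : (Ideal.span {Ideal.Quotient.mk (Ideal.span {f}) (X 0), Ideal.Quotient.mk (Ideal.span {f}) (X 1),
          Ideal.Quotient.mk (Ideal.span {f}) (X 2), Ideal.Quotient.mk (Ideal.span {f}) (X 3) ^ 2, Ideal.Quotient.mk (Ideal.span {f}) (X 4)} :
            Ideal (MvPolynomial (Fin 5) k ⧸ Ideal.span {f})) ≤ y.asIdeal := fun a ha => hy ha
    have h1 : v.asIdeal ≤ y.asIdeal := by
      rw [hv]
      exact (TauFloorP2d4BNotFull.span_range_X_le_radical_tau k f).trans ((y.2.radical_le_iff).mpr hτy)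
    have h2 : y.asIdeal ≤ v.asIdeal := (PrimeSpectrum.le_iff_specializes y v).mpr hyv
    exact PrimeSpectrum.ext (le_antisymm h2 h1)
  have h34 := LocalBlowupInputFromCharts.offFibre_regular_and_cmCl_over v (affineBlowup.isBlowup _) hsupp
    (P2d4BSpecimen.regular_of_ne_vertex k f hf v hv) (fun b hb => cmCl_stalk_affineBlowup_over k f hf v hv b hb) hg
  exact ⟨comap_fromSpecStalk_ne_bot (affineBlowup.idealSheaf_ne_bot (P2d4BTauKBlowupFull.span_tau_ne_bot k f hf)) v,
    TauFloorInputLegal.support_comap_subset_compl_regularLocus v _ hsupp (P2d4BSpecimen.vertex_not_mem_regularLocus k f hf v hv), h34.1, h34.2⟩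

/-! ## §5 ★★★ Row #3 of the F(4)-pos ledger, TWO-SIDED, as one theorem -/

/-- ★★★ **ROW #3 (P2d4B τ-floor; char 2, any field) AS ONE KERNEL THEOREM: LEGAL ∧ NOT F(4)-iso ∧ CURED.** For every blowing up `g : S′ → Spec 𝒪_{X,v}`
along `I = τ̃|_{Spec 𝒪_{X,v}}`: (legal, §4) `I ≠ ⊥`, `Supp I ⊆ (Reg)ᶜ`, `S′` regular off the closed fibre and CM everywhere; (pos, p635954) some stalk of `S′` over
the closed point is NOT FULL; (cured, p630677 over res-L1-w45a-stub-2's certificate `hrow_P2d4B` and res-L1-w45a-idea-1's `τ·K` fan) there is `𝓚 ≠ ⊥` on `S′`,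
supported over the closed point, ALL of whose blowings up are FULL at every stalk. [OURS · assembly of landed theorems] -/
theorem f4pos_row_three [CharP k 2] (f : MvPolynomial (Fin 5) k) (hf : f = X 4 ^ 2 + X 0 ^ 2 * X 4 + X 1 ^ 3 + X 2 ^ 3 + X 3 ^ 5)
    (v : Spec (.of (MvPolynomial (Fin 5) k ⧸ Ideal.span {f})))
    (hv : v.asIdeal = Ideal.span (Set.range fun j : Fin 5 => Ideal.Quotient.mk (Ideal.span {f}) (X j)))
    (S' : Scheme.{0}) (g : S' ⟶ Spec ((Spec (.of (MvPolynomial (Fin 5) k ⧸ Ideal.span {f}))).presheaf.stalk v))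
    (hg : IsBlowup g ((affineBlowup.idealSheaf
        (Ideal.span {Ideal.Quotient.mk (Ideal.span {f}) (X 0), Ideal.Quotient.mk (Ideal.span {f}) (X 1),
          Ideal.Quotient.mk (Ideal.span {f}) (X 2), Ideal.Quotient.mk (Ideal.span {f}) (X 3) ^ 2, Ideal.Quotient.mk (Ideal.span {f}) (X 4)})).comap
        ((Spec (.of (MvPolynomial (Fin 5) k ⧸ Ideal.span {f}))).fromSpecStalk v))) :
    ((affineBlowup.idealSheaf
        (Ideal.span {Ideal.Quotient.mk (Ideal.span {f}) (X 0), Ideal.Quotient.mk (Ideal.span {f}) (X 1),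
          Ideal.Quotient.mk (Ideal.span {f}) (X 2), Ideal.Quotient.mk (Ideal.span {f}) (X 3) ^ 2, Ideal.Quotient.mk (Ideal.span {f}) (X 4)})).comap
        ((Spec (.of (MvPolynomial (Fin 5) k ⧸ Ideal.span {f}))).fromSpecStalk v) ≠ ⊥ ∧
    ((((affineBlowup.idealSheaf
        (Ideal.span {Ideal.Quotient.mk (Ideal.span {f}) (X 0), Ideal.Quotient.mk (Ideal.span {f}) (X 1),
          Ideal.Quotient.mk (Ideal.span {f}) (X 2), Ideal.Quotient.mk (Ideal.span {f}) (X 3) ^ 2, Ideal.Quotient.mk (Ideal.span {f}) (X 4)})).comap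
        ((Spec (.of (MvPolynomial (Fin 5) k ⧸ Ideal.span {f}))).fromSpecStalk v)).support :
          Set (Spec ((Spec (.of (MvPolynomial (Fin 5) k ⧸ Ideal.span {f}))).presheaf.stalk v))) ⊆
      (Scheme.regularLocus (Spec ((Spec (.of (MvPolynomial (Fin 5) k ⧸ Ideal.span {f}))).presheaf.stalk v)))ᶜ) ∧
    (∀ s : S', g.base s ≠ closedPoint ((Spec (.of (MvPolynomial (Fin 5) k ⧸ Ideal.span {f}))).presheaf.stalk v) → s ∈ Scheme.regularLocus S') ∧
    (∀ s : S', CMCl (S'.presheaf.stalk s))) ∧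
    (∃ s : S', g.base s = closedPoint ((Spec (.of (MvPolynomial (Fin 5) k ⧸ Ideal.span {f}))).presheaf.stalk v) ∧ ¬ FullCl 2 (S'.presheaf.stalk s)) ∧
    (∃ 𝓚 : S'.IdealSheafData, 𝓚 ≠ ⊥ ∧
      (∀ s ∈ (𝓚.support : Set S'), g.base s = closedPoint ((Spec (.of (MvPolynomial (Fin 5) k ⧸ Ideal.span {f}))).presheaf.stalk v)) ∧
      ∀ (S'' : Scheme.{0}) (π : S'' ⟶ S'), IsBlowup π 𝓚 → ∀ s : S'', FullCl 2 (S''.presheaf.stalk s)) :=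
  ⟨tauFloor_P2d4B_legal k f hf v hv S' g hg, TauFloorP2d4BNotFull.tauFloor_P2d4B_not_full k f hf v hv S' g hg,
    TauFloorP2d4BRow.tauFloor_P2d4B_row k f hf v hv S' g hg⟩

end Summit.ResolutionOfSingularities.ResolutionOfSingularities.Theorems.FInjectiveMacaulayfication.TauFloorP2d4BLegal

end
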